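import Literature.Computability.Complexity.BitLayout
import Mathlib.Data.Nat.Size
import HarnessLib

/-!
# Bit formats: fixed-width writings of data with total readers

Trunk T-CPLX-CORE, generic; companion of `BitLayout.lean`. A `BitFormat α N` is a pair
(`write : α → (Fin N → Bool)`, `read : (Fin N → Bool) → α`) with NO law: the reader is total
(every bit string is SOME datum — what a verifier parsing an adversary's message needs), and
`read (write a) = a` is proved per combinator under the hypothesis that `a` fits the format
(`Faithful`): always for a layout (`ofLayout`), for numbers below `2^b` (`natB`), for present/absent
data (`option`), for lists of length at most the capacity (`blist`), for finite sets of bounded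
size (`bfinset`), and componentwise for products and tuples (`prod`, `pi`, `ofEquiv`). Strings:
`toList`/`ofList` move between `Fin N → Bool` and `List Bool`, and reading a string padded or
truncated to any length `≥ N` (`List.takeD`) gives the same datum (`read_ofList_takeD`).
Written for the message code of the App. D campaign
(`Literature.Barriers.PneNP.AkaviaEtAl2006_complMemAM`) but independent of it. All proved, [folklore].

## References

* [AroraBarakCC2009] S. Arora, B. Barak, *Computational Complexity: A Modern Approach*, CUP 2009,
  §1.2 (representing objects as strings).
-/

namespace Literature.Computability.Complexity

open Finset

/-- **A fixed-width format**: a writing of `α` in `N` bits and a total reading. [folklore] -/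
structure BitFormat (α : Type*) (N : ℕ) where
  /-- writing -/
  write : α → (Fin N → Bool)
  /-- reading (total) -/
  read : (Fin N → Bool) → α

namespace BitFormat

variable {α β : Type*} {N N₁ N₂ : ℕ}

/-- `a` is transmitted faithfully. [folklore] -/
def Faithful (Φ : BitFormat α N) (a : α) : Prop := Φ.read (Φ.write a) = a

/-! ### Layouts are formats -/

/-- A layout (bijective code) as a format. [folklore] -/
def ofLayout (L : BitLayout α N) : BitFormat α N := ⟨L.equiv, L.equiv.symm⟩

/-- Layouts are faithful everywhere. [folklore] -/
@[simp] theorem faithful_ofLayout (L : BitLayout α N) (a : α) : (ofLayout L).Faithful a :=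
  L.equiv.symm_apply_apply a

/-- Transport along a bijection. [folklore] -/
def ofEquiv (e : β ≃ α) (Φ : BitFormat α N) : BitFormat β N := ⟨fun b => Φ.write (e b), fun v => e.symm (Φ.read v)⟩

/-- Transport preserves faithfulness. [folklore] -/
theorem faithful_ofEquiv (e : β ≃ α) (Φ : BitFormat α N) {b : β} (h : Φ.Faithful (e b)) : (ofEquiv e Φ).Faithful b := by
  unfold Faithful ofEquiv at *; simp [h]

/-! ### Products and tuples -/

/-- Splitting a string of length `N₁ + N₂`. [folklore] -/
def split (v : Fin (N₁ + N₂) → Bool) : (Fin N₁ → Bool) × (Fin N₂ → Bool) :=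
  (fun i => v (Fin.castAdd N₂ i), fun j => v (Fin.natAdd N₁ j))

/-- Joining two strings. [folklore] -/
def join (p : (Fin N₁ → Bool) × (Fin N₂ → Bool)) : Fin (N₁ + N₂) → Bool := Fin.append p.1 p.2

/-- `split ∘ join = id`. [folklore] -/
@[simp] theorem split_join (p : (Fin N₁ → Bool) × (Fin N₂ → Bool)) : split (join p) = p := by
  unfold split join; ext i <;> simp

/-- **Concatenation of formats.** [folklore] -/
def prod (Φ₁ : BitFormat α N₁) (Φ₂ : BitFormat β N₂) : BitFormat (α × β) (N₁ + N₂) :=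
  ⟨fun p => join (Φ₁.write p.1, Φ₂.write p.2), fun v => (Φ₁.read (split v).1, Φ₂.read (split v).2)⟩

/-- A pair is faithful iff both components are. [folklore] -/
theorem faithful_prod (Φ₁ : BitFormat α N₁) (Φ₂ : BitFormat β N₂) {p : α × β} (h₁ : Φ₁.Faithful p.1) (h₂ : Φ₂.Faithful p.2) :
    (prod Φ₁ Φ₂).Faithful p := by
  unfold Faithful prod at *
  simp [h₁, h₂]

/-- Block `i` of a string of `k` blocks of `N` bits. [folklore] -/
def block (k : ℕ) (v : Fin (k * N) → Bool) (i : Fin k) : Fin N → Bool := fun j => v (finProdFinEquiv (i, j))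

/-- Laying `k` blocks side by side. [folklore] -/
def blocks (k : ℕ) (g : Fin k → Fin N → Bool) : Fin (k * N) → Bool := fun p => g (finProdFinEquiv.symm p).1 (finProdFinEquiv.symm p).2

/-- `block ∘ blocks = id`. [folklore] -/
@[simp] theorem block_blocks (k : ℕ) (g : Fin k → Fin N → Bool) (i : Fin k) : block k (blocks k g) i = g i := by
  funext j; simp [block, blocks]

/-- **Tuples**: `k` consecutive blocks. [folklore] -/
def pi (Φ : BitFormat α N) (k : ℕ) : BitFormat (Fin k → α) (k * N) :=
  ⟨fun g => blocks k fun i => Φ.write (g i), fun v i => Φ.read (block k v i)⟩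

/-- Reading back block `i` of a written tuple. [folklore] -/
@[simp] theorem read_pi_write (Φ : BitFormat α N) (k : ℕ) (g : Fin k → α) (i : Fin k) :
    (pi Φ k).read ((pi Φ k).write g) i = Φ.read (Φ.write (g i)) := by
  simp [pi]

/-- A tuple is faithful iff every component is. [folklore] -/
theorem faithful_pi (Φ : BitFormat α N) (k : ℕ) {g : Fin k → α} (h : ∀ i, Φ.Faithful (g i)) : (pi Φ k).Faithful g := by
  unfold Faithful at *
  funext i; rw [read_pi_write]; exact h i

/-! ### Numbers, options, bounded lists, bounded finite sets -/

/-- **Numbers in `b` bits** (binary via `BitLayout.finPow`; a number `≥ 2^b` is written as `2^b - 1`). [folklore] -/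
def natB (b : ℕ) : BitFormat ℕ b :=
  ⟨fun n => (BitLayout.finPow b).equiv ⟨min n (2 ^ b - 1), by have := Nat.one_le_two_pow (n := b); omega⟩,
   fun v => ((BitLayout.finPow b).equiv.symm v : ℕ)⟩

/-- Numbers below `2^b` are faithful. [folklore] -/
theorem faithful_natB {b n : ℕ} (h : n < 2 ^ b) : (natB b).Faithful n := by
  unfold Faithful natB
  simp only [Equiv.symm_apply_apply]
  simp; omega

/-- The reading of `natB` is below `2^b`. [folklore] -/
theorem read_natB_lt (b : ℕ) (v : Fin b → Bool) : (natB b).read v < 2 ^ b := ((BitLayout.finPow b).equiv.symm v).isLt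

/-- **Optional data**: a presence bit, then the datum (absent: the writing of a default). [folklore] -/
def option (Φ : BitFormat α N) (d : α) : BitFormat (Option α) (1 + N) :=
  ⟨fun o => join (fun _ => o.isSome, Φ.write (o.getD d)), fun v => if (split v).1 0 then some (Φ.read (split v).2) else none⟩

/-- `none` is faithful. [folklore] -/
theorem faithful_option_none (Φ : BitFormat α N) (d : α) : (option Φ d).Faithful none := by
  unfold Faithful option; simp

/-- `some a` is faithful iff `a` is. [folklore] -/
theorem faithful_option_some (Φ : BitFormat α N) (d : α) {a : α} (h : Φ.Faithful a) : (option Φ d).Faithful (some a) := by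
  unfold Faithful option at *; simp [h]

/-- **Lists of length at most `cap`**: a length field of `cap + 1` possible values in binary
(`Nat.size cap` bits), then `cap` blocks (unused blocks: a default); the reading takes the first
`min length cap` blocks. [folklore] -/
def blist (Φ : BitFormat α N) (d : α) (cap : ℕ) : BitFormat (List α) (Nat.size cap + cap * N) :=
  ⟨fun l => join ((natB _).write l.length, (pi Φ cap).write fun i => l.getD i d),
   fun v => (List.ofFn ((pi Φ cap).read (split v).2)).take ((natB _).read (split v).1)⟩

/-- Lists of faithful items and length at most the capacity are faithful. [folklore] -/
theorem faithful_blist (Φ : BitFormat α N) (d : α) {cap : ℕ} {l : List α} (hl : l.length ≤ cap) (h : ∀ a ∈ l, Φ.Faithful a) :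
    (blist Φ d cap).Faithful l := by
  unfold Faithful blist
  simp only [split_join]
  have hlen : (natB cap.size).read ((natB cap.size).write l.length) = l.length :=
    faithful_natB (lt_of_le_of_lt hl (Nat.lt_size_self _))
  rw [hlen]
  apply List.ext_getElem
  · simp; omega
  · intro i h1 h2
    have hi : i < l.length := by simpa using h2
    have hic : i < cap := by omega
    simp only [List.getElem_take, List.getElem_ofFn]
    rw [read_pi_write]
    have e : l.getD i d = l[i] := by simp [List.getD_eq_getElem?_getD, List.getElem?_eq_getElem hi]
    rw [e]
    exact h _ (List.getElem_mem hi)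

/-- The reading of a bounded list has length at most the capacity. [folklore] -/
theorem length_read_blist_le (Φ : BitFormat α N) (d : α) (cap : ℕ) (v : Fin (Nat.size cap + cap * N) → Bool) :
    ((blist Φ d cap).read v).length ≤ cap := by
  unfold blist; simp

/-- **Finite sets of at most `cap` elements** (as the list of their elements, read back with
duplicates removed). [folklore] -/
noncomputable def bfinset [DecidableEq α] (Φ : BitFormat α N) (d : α) (cap : ℕ) : BitFormat (Finset α) (Nat.size cap + cap * N) :=
  ⟨fun s => (blist Φ d cap).write s.toList, fun v => ((blist Φ d cap).read v).toFinset⟩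

/-- Small sets of faithful elements are faithful. [folklore] -/
theorem faithful_bfinset [DecidableEq α] (Φ : BitFormat α N) (d : α) {cap : ℕ} {s : Finset α} (hs : s.card ≤ cap)
    (h : ∀ a ∈ s, Φ.Faithful a) : (bfinset Φ d cap).Faithful s := by
  unfold Faithful bfinset
  have := faithful_blist Φ d (l := s.toList) (by simpa using hs) (fun a ha => h a (Finset.mem_toList.1 ha))
  unfold Faithful at this
  simp only [this, Finset.toList_toFinset]

/-- The reading of a bounded set has at most `cap` elements. [folklore] -/
theorem card_read_bfinset_le [DecidableEq α] (Φ : BitFormat α N) (d : α) (cap : ℕ) (v : Fin (Nat.size cap + cap * N) → Bool) :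
    ((bfinset Φ d cap).read v).card ≤ cap :=
  (List.toFinset_card_le _).trans (length_read_blist_le Φ d cap v)

/-! ### Strings -/

/-- A bit string as a list. [folklore] -/
def toList (v : Fin N → Bool) : List Bool := List.ofFn v

/-- The first `N` bits of a list (missing bits read `false`). [folklore] -/
def ofList (N : ℕ) (l : List Bool) : Fin N → Bool := fun i => l.getD i false

/-- `|toList v| = N`. [folklore] -/
@[simp] theorem length_toList (v : Fin N → Bool) : (toList v).length = N := List.length_ofFn

/-- `ofList ∘ toList = id`. [folklore] -/
@[simp] theorem ofList_toList (v : Fin N → Bool) : ofList N (toList v) = v := by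
  funext i; simp [ofList, toList, List.getD_eq_getElem?_getD]

/-- Reading ignores everything after the first `N` bits. [folklore] -/
theorem ofList_append (l l' : List Bool) (h : N ≤ l.length) : ofList N (l ++ l') = ofList N l := by
  funext i
  simp [ofList, List.getD_eq_getElem?_getD, List.getElem?_append_left (by omega : (i : ℕ) < l.length)]

/-- `takeD` as take-after-padding. [folklore] -/
theorem takeD_eq_take_append_replicate : ∀ (m : ℕ) (s : List Bool),
    s.takeD m false = (s ++ List.replicate m false).take m
  | 0, s => by simp
  | m + 1, [] => by simp [List.take_replicate, List.replicate_succ]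
  | m + 1, b :: s => by
    rw [List.cons_append, List.take_succ_cons, List.takeD_succ]
    simp only [List.head?_cons, Option.getD_some, List.tail_cons]
    rw [List.replicate_succ', ← List.append_assoc, List.take_append_of_le_length (by simp),
      takeD_eq_take_append_replicate m s]

/-- **Normalising a written string to any length `m ≥ N` (truncate / pad with `false`) does not
change what is read.** [folklore] -/
theorem ofList_takeD (l : List Bool) {m : ℕ} (h : N ≤ m) : ofList N (l.takeD m false) = ofList N l := by
  funext i
  simp only [ofList, List.getD_eq_getElem?_getD]
  have hi : (i : ℕ) < m := lt_of_lt_of_le i.isLt h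
  rw [takeD_eq_take_append_replicate, List.getElem?_take_of_lt hi, List.getElem?_append]
  split_ifs with hlt
  · rfl
  · rw [List.getElem?_eq_none (not_lt.1 hlt)]
    simp only [List.getElem?_replicate, Option.getD_none]
    split_ifs <;> rfl

/-- A written string of a format, padded or truncated to length `m ≥ N`, reads back as the datum
read from the written string. [folklore] -/
theorem read_ofList_takeD (Φ : BitFormat α N) (a : α) {m : ℕ} (h : N ≤ m) :
    Φ.read (ofList N ((toList (Φ.write a)).takeD m false)) = Φ.read (Φ.write a) := by
  rw [ofList_takeD _ h, ofList_toList]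

end BitFormat

end Literature.Computability.Complexity
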